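import Mathlib
import Summits.ValiantsHypothesis.ValiantsHypothesis.Theorems.RigidityForcesSymmetryRigidityForcesTorus
import Summits.ValiantsHypothesis.ValiantsHypothesis.Theorems.RigidityForcesSymmetryRigidMinimalReprStubSliceOpen
import Summits.ValiantsHypothesis.ValiantsHypothesis.Theorems.RigidityForcesSymmetryRigidMinimalReprStubPencilLocInj

/-!
# Crux `RigidityForcesSymmetry.RigidMinimalRepr` (stmt-ValiantsHypothesis-4163), line `registered` —
# stub `stub_infRigidToLocallyOpen` (INFINITESIMAL RIGIDITY ⇒ LOCALLY OPEN GAUGE ORBIT), assembled from the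
# landed stubs `stub_sliceOpen` + `stub_pencilLocInj`

Route `ValiantsHypothesis/RigidityForcesSymmetry`, crux `RigidMinimalRepr`, skeleton
`Cruxes/RigidMinimalRepr/Lines/registered.lean` (lead's reshape v2).  This is the layer-2 child
`InfRigidToLocallyOpen` of the route's TWO-LAYER PLAN for `RigidMinimalRepr` (and for `RigidAtThree`): it reduces
the crux to the purely first-order statement `stub_infinitesimallyRigidMinimal` (infinitesimal rigidity of some
size-minimal representation of `per_n`, infinitely often).

**Statement (stub 2 of the line).** For a finite variable type `ι`, a nonzero `f ∈ ℂ[x_ι]` and a pencil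
`x₀ = (Λ, A)` of size `m` with `det x̃₀ = f` (`x̃₀ = Λ + Σ_v x_v A_v`), INFINITESIMAL RIGIDITY — every
`B = (Λ', A')` with `tr(adj(x̃₀) B̃) = 0` is a gauge direction `(PΛ − ΛQ, (PA_v − A_vQ)_v)` — implies that
some neighbourhood of `x₀` in coefficient space `X = M_m × (ι → M_m)` meets `{det = f}` only inside the
`GL_m × GL_m`-orbit `{(gΛh⁻¹, (gA_vh⁻¹)_v)}`.

**Proof (slice argument).** Let `T = {(PΛ + ΛQ, (PA_v + A_vQ)_v)}` (gauge tangent space, the range of a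
linear map `τ`) and choose a linear complement `W` of `T` in `X` (`Submodule.exists_isCompl`).
* `stub_sliceOpen` (inverse function theorem): the polynomial map
  `Θ(P, Q, w) = ((1+P)(Λ+w₁)(1+Q), ((1+P)(A_v+w₂ᵥ)(1+Q))_v)` covers a neighbourhood `U` of `x₀` by
  parameters `(P, Q, w)` from any prescribed neighbourhood `V` of `0`, with `w ∈ W`.
* `stub_pencilLocInj` (Jacobi + injective differential): for `(c, w)` near `(1, 0)` with `w ∈ W`,
  `det((x₀ + w)~) = c · f` forces `w = 0`.
Take `V` so small that `1 + P`, `1 + Q` are invertible and `((det(1+P) det(1+Q))⁻¹, w)` lies in the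
neighbourhood of `stub_pencilLocInj`.  If `p = Θ(P, Q, w) ∈ U` has `det p̃ = f`, then
`p̃ = (1+P)·(x₀ + w)~·(1+Q)` (`rft_map_C_mul_pencil_mul_map_C`, tree) gives
`det((x₀+w)~) = (det(1+P) det(1+Q))⁻¹ · f`, hence `w = 0` and `p = (gΛh⁻¹, (gA_vh⁻¹)_v)` with
`g = 1 + P`, `h = (1 + Q)⁻¹`.
-/

noncomputable section

-- `Summit.ValiantsHypothesis.ValiantsHypothesis.…` is the tree's mandated single-conjunct layout (Sub = Summit).
set_option linter.dupNamespace false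

namespace Summit.ValiantsHypothesis.ValiantsHypothesis.Theorems.RigidityForcesSymmetryRigidMinimalRepr

open MvPolynomial Matrix Filter Topology

/-- **Stub 2 from stubs 2a and 2b.** Infinitesimal rigidity of a pencil point of `{det = f}`, `f ≠ 0`,
implies that its `GL_m × GL_m`-orbit is locally open there (the `nhds`-form of the crux), given the
orbit–slice openness statement `hS` (`stub_sliceOpen`) and the slice local-injectivity statement `hJ`
(`stub_pencilLocInj`). -/
theorem infRigidToLocallyOpen_of_slice
    (hS : ∀ (ι : Type) [Fintype ι] (m : ℕ) (Λ : Matrix (Fin m) (Fin m) ℂ) (A : ι → Matrix (Fin m) (Fin m) ℂ)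
      (W : Submodule ℂ (Matrix (Fin m) (Fin m) ℂ × (ι → Matrix (Fin m) (Fin m) ℂ))),
      (∀ x : Matrix (Fin m) (Fin m) ℂ × (ι → Matrix (Fin m) (Fin m) ℂ),
        ∃ (P Q : Matrix (Fin m) (Fin m) ℂ), ∃ w ∈ W,
          x = (P * Λ + Λ * Q, fun v => P * A v + A v * Q) + w) →
      ∀ V ∈ nhds (0 : (Matrix (Fin m) (Fin m) ℂ × Matrix (Fin m) (Fin m) ℂ) ×
                    (Matrix (Fin m) (Fin m) ℂ × (ι → Matrix (Fin m) (Fin m) ℂ))),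
        ∃ U ∈ nhds (Λ, A), ∀ p ∈ U, ∃ q ∈ V, q.2 ∈ W ∧
          p = ((1 + q.1.1) * (Λ + q.2.1) * (1 + q.1.2),
               fun v => (1 + q.1.1) * (A v + q.2.2 v) * (1 + q.1.2)))
    (hJ : ∀ (ι : Type) [Fintype ι] (m : ℕ) (f : MvPolynomial ι ℂ) (Λ : Matrix (Fin m) (Fin m) ℂ)
      (A : ι → Matrix (Fin m) (Fin m) ℂ)
      (W : Submodule ℂ (Matrix (Fin m) (Fin m) ℂ × (ι → Matrix (Fin m) (Fin m) ℂ))),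
      f ≠ 0 →
      (Λ.map MvPolynomial.C + ∑ v, (MvPolynomial.X v : MvPolynomial ι ℂ) • (A v).map MvPolynomial.C).det = f →
      (∀ (Λ' : Matrix (Fin m) (Fin m) ℂ) (A' : ι → Matrix (Fin m) (Fin m) ℂ),
        ((Λ.map MvPolynomial.C + ∑ v, (MvPolynomial.X v : MvPolynomial ι ℂ) • (A v).map MvPolynomial.C).adjugate
            * (Λ'.map MvPolynomial.C + ∑ v, (MvPolynomial.X v : MvPolynomial ι ℂ) • (A' v).map MvPolynomial.C)).trace
          = (0 : MvPolynomial ι ℂ) →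
        ∃ P Q : Matrix (Fin m) (Fin m) ℂ, Λ' = P * Λ - Λ * Q ∧ ∀ v, A' v = P * A v - A v * Q) →
      (∀ (P Q : Matrix (Fin m) (Fin m) ℂ), ∀ w ∈ W,
        ((P * Λ + Λ * Q, fun v => P * A v + A v * Q) :
            Matrix (Fin m) (Fin m) ℂ × (ι → Matrix (Fin m) (Fin m) ℂ)) = w →
        w = 0) →
      ∃ N ∈ nhds ((1 : ℂ), (0 : Matrix (Fin m) (Fin m) ℂ × (ι → Matrix (Fin m) (Fin m) ℂ))),
        ∀ cw ∈ N, cw.2 ∈ W →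
          ((Λ + cw.2.1).map MvPolynomial.C +
              ∑ v, (MvPolynomial.X v : MvPolynomial ι ℂ) • (A v + cw.2.2 v).map MvPolynomial.C).det
            = MvPolynomial.C cw.1 * f →
          cw.2 = 0) :
    ∀ (ι : Type) [Fintype ι] (m : ℕ) (f : MvPolynomial ι ℂ) (Λ : Matrix (Fin m) (Fin m) ℂ)
      (A : ι → Matrix (Fin m) (Fin m) ℂ),
      f ≠ 0 →
      (Λ.map MvPolynomial.C + ∑ v, (MvPolynomial.X v : MvPolynomial ι ℂ) • (A v).map MvPolynomial.C).det = f →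
      (∀ (Λ' : Matrix (Fin m) (Fin m) ℂ) (A' : ι → Matrix (Fin m) (Fin m) ℂ),
        ((Λ.map MvPolynomial.C + ∑ v, (MvPolynomial.X v : MvPolynomial ι ℂ) • (A v).map MvPolynomial.C).adjugate
            * (Λ'.map MvPolynomial.C + ∑ v, (MvPolynomial.X v : MvPolynomial ι ℂ) • (A' v).map MvPolynomial.C)).trace
          = (0 : MvPolynomial ι ℂ) →
        ∃ P Q : Matrix (Fin m) (Fin m) ℂ, Λ' = P * Λ - Λ * Q ∧ ∀ v, A' v = P * A v - A v * Q) →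
      ∃ U ∈ nhds (Λ, A), ∀ p ∈ U,
        (p.1.map MvPolynomial.C + ∑ v, (MvPolynomial.X v : MvPolynomial ι ℂ) • (p.2 v).map MvPolynomial.C).det = f →
        ∃ g h : GL (Fin m) ℂ,
          p.1 = (g : Matrix (Fin m) (Fin m) ℂ) * Λ * ((h⁻¹ : GL (Fin m) ℂ) : Matrix (Fin m) (Fin m) ℂ) ∧
          ∀ v, p.2 v = (g : Matrix (Fin m) (Fin m) ℂ) * A v * ((h⁻¹ : GL (Fin m) ℂ) : Matrix (Fin m) (Fin m) ℂ) := by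
  intro ι _ m f Λ A hf hdet hT
  classical
  -- the gauge tangent map `τ (P, Q) = (PΛ + ΛQ, (P A_v + A_v Q)_v)` and a linear complement `W` of its range
  let τ : (Matrix (Fin m) (Fin m) ℂ × Matrix (Fin m) (Fin m) ℂ) →ₗ[ℂ]
      (Matrix (Fin m) (Fin m) ℂ × (ι → Matrix (Fin m) (Fin m) ℂ)) :=
    ((LinearMap.mulRight ℂ Λ).comp (LinearMap.fst ℂ _ _) +
        (LinearMap.mulLeft ℂ Λ).comp (LinearMap.snd ℂ _ _)).prod
      (LinearMap.pi fun v =>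
        (LinearMap.mulRight ℂ (A v)).comp (LinearMap.fst ℂ _ _) +
          (LinearMap.mulLeft ℂ (A v)).comp (LinearMap.snd ℂ _ _))
  have hτ : ∀ P Q : Matrix (Fin m) (Fin m) ℂ,
      τ (P, Q) = (P * Λ + Λ * Q, fun v => P * A v + A v * Q) := fun P Q => rfl
  obtain ⟨W, hW⟩ := Submodule.exists_isCompl (LinearMap.range τ)
  have hsup : ∀ x : Matrix (Fin m) (Fin m) ℂ × (ι → Matrix (Fin m) (Fin m) ℂ),
      ∃ (P Q : Matrix (Fin m) (Fin m) ℂ), ∃ w ∈ W,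
        x = (P * Λ + Λ * Q, fun v => P * A v + A v * Q) + w := by
    intro x
    have hx : x ∈ LinearMap.range τ ⊔ W := by rw [hW.sup_eq_top]; trivial
    obtain ⟨t, ht, w, hw, rfl⟩ := Submodule.mem_sup.1 hx
    obtain ⟨⟨P, Q⟩, rfl⟩ := LinearMap.mem_range.1 ht
    exact ⟨P, Q, w, hw, by rw [hτ]⟩
  have hinf : ∀ (P Q : Matrix (Fin m) (Fin m) ℂ), ∀ w ∈ W,
      ((P * Λ + Λ * Q, fun v => P * A v + A v * Q) :
          Matrix (Fin m) (Fin m) ℂ × (ι → Matrix (Fin m) (Fin m) ℂ)) = w → w = 0 := by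
    intro P Q w hw h
    have ht : w ∈ LinearMap.range τ := LinearMap.mem_range.2 ⟨(P, Q), by rw [hτ, h]⟩
    have hbot : w ∈ LinearMap.range τ ⊓ W := Submodule.mem_inf.2 ⟨ht, hw⟩
    rw [hW.inf_eq_bot] at hbot
    simpa using hbot
  obtain ⟨N, hN, hJ'⟩ := hJ ι m f Λ A W hf hdet hT hinf
  -- the parameter neighbourhood `V` of `0`
  let κ : (Matrix (Fin m) (Fin m) ℂ × Matrix (Fin m) (Fin m) ℂ) ×
        (Matrix (Fin m) (Fin m) ℂ × (ι → Matrix (Fin m) (Fin m) ℂ)) →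
      ℂ × (Matrix (Fin m) (Fin m) ℂ × (ι → Matrix (Fin m) (Fin m) ℂ)) :=
    fun q => (((1 + q.1.1).det * (1 + q.1.2).det)⁻¹, q.2)
  have hc1 : Continuous fun q : (Matrix (Fin m) (Fin m) ℂ × Matrix (Fin m) (Fin m) ℂ) ×
      (Matrix (Fin m) (Fin m) ℂ × (ι → Matrix (Fin m) (Fin m) ℂ)) => (1 + q.1.1).det :=
    (continuous_const.add (continuous_fst.comp continuous_fst)).matrix_det
  have hc2 : Continuous fun q : (Matrix (Fin m) (Fin m) ℂ × Matrix (Fin m) (Fin m) ℂ) ×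
      (Matrix (Fin m) (Fin m) ℂ × (ι → Matrix (Fin m) (Fin m) ℂ)) => (1 + q.1.2).det :=
    (continuous_const.add (continuous_snd.comp continuous_fst)).matrix_det
  have hκ : ContinuousAt κ 0 := by
    refine ContinuousAt.prodMk ?_ continuous_snd.continuousAt
    refine ((hc1.mul hc2).continuousAt).inv₀ ?_
    simp
  have hκ0 : κ 0 = (1, 0) := by simp [κ]
  have hV1 : κ ⁻¹' N ∈ 𝓝 (0 : (Matrix (Fin m) (Fin m) ℂ × Matrix (Fin m) (Fin m) ℂ) ×
      (Matrix (Fin m) (Fin m) ℂ × (ι → Matrix (Fin m) (Fin m) ℂ))) :=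
    hκ.preimage_mem_nhds (by rw [hκ0]; exact hN)
  have hV2 : ∀ᶠ q in 𝓝 (0 : (Matrix (Fin m) (Fin m) ℂ × Matrix (Fin m) (Fin m) ℂ) ×
      (Matrix (Fin m) (Fin m) ℂ × (ι → Matrix (Fin m) (Fin m) ℂ))), (1 + q.1.1).det ≠ 0 :=
    hc1.continuousAt.eventually_ne (by simp)
  have hV3 : ∀ᶠ q in 𝓝 (0 : (Matrix (Fin m) (Fin m) ℂ × Matrix (Fin m) (Fin m) ℂ) ×
      (Matrix (Fin m) (Fin m) ℂ × (ι → Matrix (Fin m) (Fin m) ℂ))), (1 + q.1.2).det ≠ 0 :=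
    hc2.continuousAt.eventually_ne (by simp)
  obtain ⟨U, hU, hU'⟩ := hS ι m Λ A W hsup _ (inter_mem hV1 (hV2.and hV3))
  refine ⟨U, hU, fun p hp hpdet => ?_⟩
  obtain ⟨q, ⟨hq1, hq2, hq3⟩, hqW, rfl⟩ := hU' p hp
  -- `det p̃ = det(1+P) · det((x₀+w)~) · det(1+Q)`
  have hpencil := Summit.ValiantsHypothesis.ValiantsHypothesis.Theorems.rft_map_C_mul_pencil_mul_map_C
    (1 + q.1.1) (1 + q.1.2) (Λ + q.2.1) (fun v => A v + q.2.2 v)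
  dsimp only at hpdet
  rw [← hpencil, det_mul, det_mul] at hpdet
  have hmapdet : ∀ N : Matrix (Fin m) (Fin m) ℂ,
      (N.map (C : ℂ →+* MvPolynomial ι ℂ)).det = (C N.det : MvPolynomial ι ℂ) := fun N => by
    rw [← RingHom.mapMatrix_apply, ← RingHom.map_det]
  rw [hmapdet, hmapdet] at hpdet
  have hab : (1 + q.1.1).det * (1 + q.1.2).det ≠ 0 := mul_ne_zero hq2 hq3
  have key : ((Λ + (κ q).2.1).map MvPolynomial.C +
        ∑ v, (MvPolynomial.X v : MvPolynomial ι ℂ) • (A v + (κ q).2.2 v).map MvPolynomial.C).det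
      = MvPolynomial.C (κ q).1 * f := by
    show ((Λ + q.2.1).map C + ∑ v, (X v : MvPolynomial ι ℂ) • (A v + q.2.2 v).map C).det
      = C ((1 + q.1.1).det * (1 + q.1.2).det)⁻¹ * f
    rw [← hpdet]
    set D : MvPolynomial ι ℂ :=
      ((Λ + q.2.1).map C + ∑ v, (X v : MvPolynomial ι ℂ) • (A v + q.2.2 v).map C).det with hD
    calc D = C (((1 + q.1.1).det * (1 + q.1.2).det)⁻¹ * ((1 + q.1.1).det * (1 + q.1.2).det)) * D := by
          rw [inv_mul_cancel₀ hab, C_1, one_mul]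
      _ = C ((1 + q.1.1).det * (1 + q.1.2).det)⁻¹ * (C (1 + q.1.1).det * D * C (1 + q.1.2).det) := by
          rw [C_mul, C_mul]; ring
  have hw0 : q.2 = 0 := hJ' (κ q) hq1 hqW key
  refine ⟨Matrix.GeneralLinearGroup.mkOfDetNeZero _ hq2,
    (Matrix.GeneralLinearGroup.mkOfDetNeZero _ hq3)⁻¹, ?_, fun v => ?_⟩
  · simp [hw0, Matrix.GeneralLinearGroup.mkOfDetNeZero]
  · simp [hw0, Matrix.GeneralLinearGroup.mkOfDetNeZero]

/-- **Stub 2 (`stub_infRigidToLocallyOpen`) of line `registered` for crux `RigidMinimalRepr` — infinitesimal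
rigidity implies a locally open gauge orbit.**  For any finite variable type `ι`, any nonzero `f ∈ ℂ[x_ι]` and
any pencil `(Λ, A)` of size `m` with `det(Λ + Σ_v x_v A_v) = f`: if every `(Λ', A')` with
`tr(adj(Ã)·(Λ' + Σ_v x_v A'_v)) = 0` is of the form `(PΛ − ΛQ, (PA_v − A_vQ)_v)`, then some neighbourhood of
`(Λ, A)` in coefficient space meets `{det = f}` only inside the `GL_m × GL_m`-orbit `{(gΛh⁻¹, (gA_vh⁻¹)_v)}`.
Assembled from `stub_sliceOpen` (inverse function theorem) and `stub_pencilLocInj` (Jacobi + injective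
differential) by `infRigidToLocallyOpen_of_slice`. -/
theorem stub_infRigidToLocallyOpen :
    ∀ (ι : Type) [Fintype ι] (m : ℕ) (f : MvPolynomial ι ℂ) (Λ : Matrix (Fin m) (Fin m) ℂ) (A : ι → Matrix (Fin m) (Fin m) ℂ),
      f ≠ 0 →
      (Λ.map MvPolynomial.C + ∑ v, (MvPolynomial.X v : MvPolynomial ι ℂ) • (A v).map MvPolynomial.C).det = f →
      (∀ (Λ' : Matrix (Fin m) (Fin m) ℂ) (A' : ι → Matrix (Fin m) (Fin m) ℂ),
        ((Λ.map MvPolynomial.C + ∑ v, (MvPolynomial.X v : MvPolynomial ι ℂ) • (A v).map MvPolynomial.C).adjugate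
            * (Λ'.map MvPolynomial.C + ∑ v, (MvPolynomial.X v : MvPolynomial ι ℂ) • (A' v).map MvPolynomial.C)).trace
          = (0 : MvPolynomial ι ℂ) →
        ∃ P Q : Matrix (Fin m) (Fin m) ℂ, Λ' = P * Λ - Λ * Q ∧ ∀ v, A' v = P * A v - A v * Q) →
      ∃ U ∈ nhds (Λ, A), ∀ p ∈ U,
        (p.1.map MvPolynomial.C + ∑ v, (MvPolynomial.X v : MvPolynomial ι ℂ) • (p.2 v).map MvPolynomial.C).det = f →
        ∃ g h : GL (Fin m) ℂ,
          p.1 = (g : Matrix (Fin m) (Fin m) ℂ) * Λ * ((h⁻¹ : GL (Fin m) ℂ) : Matrix (Fin m) (Fin m) ℂ) ∧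
          ∀ v, p.2 v = (g : Matrix (Fin m) (Fin m) ℂ) * A v * ((h⁻¹ : GL (Fin m) ℂ) : Matrix (Fin m) (Fin m) ℂ) :=
  infRigidToLocallyOpen_of_slice stub_sliceOpen stub_pencilLocInj

end Summit.ValiantsHypothesis.ValiantsHypothesis.Theorems.RigidityForcesSymmetryRigidMinimalRepr

end
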